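import Mathlib
import HarnessLib
import Literature.MathematicalPhysics.KineticTheory.VelocityFlipNoise
import Literature.MathematicalPhysics.KineticTheory.LangevinChainGibbs
import Summits.AtomisticToContinuum.FouriersLaw.Theorems.VanishingNoiseTransferNoiseLocalityStubResponseDensityNoisyAux2

/-!
# Stub A4 `stub_fixedAbelThermodynamicLimit` (line `abel-kapitza-even-corrector`, crux
`VanishingNoiseTransfer.NoisyFourier`, stmt-AtomisticToContinuum-11977): REDUCTION to one missing fact

Worker file (stub worker A4 of lead c4). The registered stub — at fixed Abel parameter `s ∈ (0,1]` the per-bond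
Green–Kubo pairing `σ_L(s)/(L−1) = ⟨J_L, u_{L,s}⟩_{μ_{L,T}}/(L−1)` of the velocity-flip pinned chain converges as
`L → ∞` for every family of classical `C² ∩ L²(μ_T)` Abel correctors — is NOT proved here: the tree has no
`L`-uniform `L²(μ_T)` locality for the FLIP-Langevin dynamics (its flip semigroup exists only as abstract
Dyson–Phillips kernels, `VanishingNoiseBound.exists_flipSemigroup`; every light-cone / severed-window /
infinite-volume statement of the tree is for the flip-FREE chain). This file isolates the ONE missing fact in the
line's own vocabulary and proves, sorry-free, that it implies the stub verbatim:

* MISSING FACT `AbelRowLocality` (hypothesis `hX` below, "row locality of the Abel pairing"): for the rows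
  `a_L(i) := ⟨j_i, u_{L,s}⟩_{μ_{L,T}}` of a family of classical Abel correctors there are `K B : ℝ` with
  (i) `|a_L(i)| ≤ B` for all `L ≥ 2`, `i` (uniform row bound = light cone of the flip chain at time horizon `1/s`)
  and (ii) for every `η > 0` there are `R L₀` with `|a_L(i) − K| ≤ η` for all `L ≥ L₀` and all `R`-deep bonds
  `R ≤ i < L − R` (bulk homogeneity = two-length / infinite-volume matching of the flip dynamics on bulk windows
  + one-dimensional equivalence of ensembles).
* `tendsto_rowAverage` — the real-analysis averaging step `(Σ_i a_L(i))/(L−1) → K`.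
* `stub_fixedAbelThermodynamicLimit_of_abelRowLocality` — `AbelRowLocality →` (the registered signature, verbatim).
-/

noncomputable section

open MeasureTheory Filter Topology
open scoped BigOperators
open Literature.MathematicalPhysics.KineticTheory.HeatConduction

namespace Summit.AtomisticToContinuum.FouriersLaw.Cruxes.NoisyFourier.AbelKapitzaEvenCorrector

open Summit.AtomisticToContinuum.FouriersLaw.Theorems.NoiseLocality.StubResponseDensityNoisy
  (memLp_bondCurrent_gibbsMeasure)

/-- Counting the non-deep indices: at most `2R` indices `i < L` fail `R ≤ i ∧ i + R < L`. [folklore] -/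
theorem card_filter_not_deep_le (L R : ℕ) :
    (Finset.univ.filter (fun i : Fin L => ¬(R ≤ i.val ∧ i.val + R < L))).card ≤ 2 * R := by
  classical
  have hsub : Finset.univ.filter (fun i : Fin L => ¬(R ≤ i.val ∧ i.val + R < L)) ⊆
      Finset.univ.filter (fun i : Fin L => i.val < R) ∪
        Finset.univ.filter (fun i : Fin L => L ≤ i.val + R) := by
    intro i hi
    simp only [Finset.mem_filter, Finset.mem_univ, true_and, not_and, not_lt] at hi
    simp only [Finset.mem_union, Finset.mem_filter, Finset.mem_univ, true_and]
    by_cases h : i.val < R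
    · exact Or.inl h
    · exact Or.inr (hi (not_lt.1 h))
  have h1 : (Finset.univ.filter (fun i : Fin L => i.val < R)).card ≤ R := by
    have h := Finset.card_le_card_of_injOn (s := Finset.univ.filter (fun i : Fin L => i.val < R))
      (t := Finset.range R) (fun i : Fin L => i.val)
      (fun i hi => by
        simp only [Finset.coe_filter, Finset.mem_univ, true_and, Set.mem_setOf_eq] at hi
        simpa using hi)
      (fun i _ j _ hij => Fin.ext hij)
    simpa using h
  have h2 : (Finset.univ.filter (fun i : Fin L => L ≤ i.val + R)).card ≤ R := by
    have h := Finset.card_le_card_of_injOn (s := Finset.univ.filter (fun i : Fin L => L ≤ i.val + R))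
      (t := Finset.range R) (fun i : Fin L => L - 1 - i.val)
      (fun i hi => by
        simp only [Finset.coe_filter, Finset.mem_univ, true_and, Set.mem_setOf_eq] at hi
        simp only [Finset.coe_range, Set.mem_Iio]
        have := i.isLt
        omega)
      (fun i _ j _ hij => by
        have hi := i.isLt
        have hj := j.isLt
        apply Fin.ext
        simp only at hij
        omega)
    simpa using h
  calc (Finset.univ.filter (fun i : Fin L => ¬(R ≤ i.val ∧ i.val + R < L))).card
      ≤ (Finset.univ.filter (fun i : Fin L => i.val < R) ∪
          Finset.univ.filter (fun i : Fin L => L ≤ i.val + R)).card := Finset.card_le_card hsub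
    _ ≤ (Finset.univ.filter (fun i : Fin L => i.val < R)).card +
          (Finset.univ.filter (fun i : Fin L => L ≤ i.val + R)).card := Finset.card_union_le _ _
    _ ≤ R + R := add_le_add h1 h2
    _ = 2 * R := by ring

/-- **Averaging rows with a uniform bound and a bulk value.** If `|a_L(i)| ≤ B` for all `L ≥ 2` and all `i`, and
for every `η > 0` the `R`-deep rows of all long chains are `η`-close to `K`, then `(Σ_i a_L(i))/(L−1) → K`:
the `≤ 2R` boundary rows weigh `O(1/L)`. [folklore] -/
theorem tendsto_rowAverage {a : (L : ℕ) → Fin L → ℝ} {K B : ℝ}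
    (hB : ∀ L : ℕ, 2 ≤ L → ∀ i : Fin L, |a L i| ≤ B)
    (hη : ∀ η : ℝ, 0 < η → ∃ R L₀ : ℕ, ∀ L : ℕ, L₀ ≤ L → ∀ i : Fin L, R ≤ i.val → i.val + R < L →
      |a L i - K| ≤ η) :
    Tendsto (fun L : ℕ => (∑ i : Fin L, a L i) / ((L : ℝ) - 1)) atTop (nhds K) := by
  classical
  rw [Metric.tendsto_atTop]
  intro ε hε
  obtain ⟨R, L₀, hRL⟩ := hη (ε / 4) (by positivity)
  have hB0 : 0 ≤ B := (abs_nonneg _).trans (hB 2 le_rfl ⟨0, by norm_num⟩)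
  set M : ℝ := 2 * R * (B + |K|) + |K| with hM
  have hM0 : 0 ≤ M := by positivity
  obtain ⟨L₁, hL₁⟩ : ∃ L₁ : ℕ, M < ε / 2 * ((L₁ : ℝ) - 1) := by
    obtain ⟨n, hn⟩ := exists_nat_gt (M / (ε / 2) + 1)
    refine ⟨n, ?_⟩
    have h : M / (ε / 2) < (n : ℝ) - 1 := by linarith
    rw [div_lt_iff₀ (by positivity)] at h
    linarith
  refine ⟨max (max L₀ 2) L₁, fun L hL => ?_⟩
  have hL₀ : L₀ ≤ L := ((le_max_left _ _).trans (le_max_left _ _)).trans hL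
  have h2 : 2 ≤ L := ((le_max_right _ _).trans (le_max_left _ _)).trans hL
  have hL₁' : L₁ ≤ L := (le_max_right _ _).trans hL
  have hLr : (2 : ℝ) ≤ (L : ℝ) := by exact_mod_cast h2
  have hL1pos : 0 < (L : ℝ) - 1 := by linarith
  have hL₁r : (L₁ : ℝ) ≤ (L : ℝ) := by exact_mod_cast hL₁'
  -- the pointwise bound on `|a_L(i) - K|`
  set p : Fin L → Prop := fun i => R ≤ i.val ∧ i.val + R < L with hp
  have hpt : ∀ i : Fin L, |a L i - K| ≤ (if p i then ε / 4 else B + |K|) := by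
    intro i
    by_cases hi : p i
    · rw [if_pos hi]; exact hRL L hL₀ i hi.1 hi.2
    · rw [if_neg hi]
      exact (abs_sub (a L i) K).trans (by linarith [hB L h2 i])
  -- summing it
  have hsum : |∑ i : Fin L, (a L i - K)| ≤ (L : ℝ) * (ε / 4) + 2 * R * (B + |K|) := by
    refine (Finset.abs_sum_le_sum_abs _ _).trans ?_
    refine (Finset.sum_le_sum fun i _ => hpt i).trans ?_
    rw [Finset.sum_ite, Finset.sum_const, Finset.sum_const, nsmul_eq_mul, nsmul_eq_mul]
    have hc1 : ((Finset.univ.filter fun i : Fin L => p i).card : ℝ) ≤ L := by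
      have h := Finset.card_filter_le (Finset.univ : Finset (Fin L)) (fun i => p i)
      rw [Finset.card_univ, Fintype.card_fin] at h
      exact_mod_cast h
    have hc2 : ((Finset.univ.filter fun i : Fin L => ¬p i).card : ℝ) ≤ 2 * R := by
      have h := card_filter_not_deep_le L R
      exact_mod_cast h
    have hBK : 0 ≤ B + |K| := by positivity
    nlinarith [hc1, hc2, hBK, hε.le]
  -- conclusion
  rw [Real.dist_eq]
  have hrew : (∑ i : Fin L, a L i) / ((L : ℝ) - 1) - K =
      ((∑ i : Fin L, (a L i - K)) + K) / ((L : ℝ) - 1) := by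
    rw [Finset.sum_sub_distrib, Finset.sum_const, Finset.card_univ, Fintype.card_fin, nsmul_eq_mul]
    field_simp
    ring
  rw [hrew, abs_div, abs_of_pos hL1pos, div_lt_iff₀ hL1pos]
  have habs : |(∑ i : Fin L, (a L i - K)) + K| ≤ (L : ℝ) * (ε / 4) + M := by
    refine (abs_add_le _ _).trans ?_
    rw [hM]
    linarith [hsum]
  have hML : M < ε / 2 * ((L : ℝ) - 1) := hL₁.trans_le (by nlinarith [hL₁r, hε.le])
  have hL4 : (L : ℝ) * (ε / 4) ≤ ε / 2 * ((L : ℝ) - 1) := by nlinarith [hLr, hε.le]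
  linarith [habs, hML, hL4]

/-- **Stub A4 from the missing fact.** If the rows `a_L(i) = ∫ j_i · u_L dμ_{L,T}` of every family of classical
Abel correctors at `s ∈ (0,1]` obey the ROW LOCALITY `AbelRowLocality` (uniform row bound + bulk homogeneity,
hypothesis `hX`), then `∫ J_L · u_L dμ_{L,T} /(L−1)` converges (to the bulk row value `K`): `J_L = Σ_i j_i`, each
`j_i, u_L ∈ L²(μ_{L,T})`, so `∫ J_L u_L = Σ_i a_L(i)` and `tendsto_rowAverage` applies. The conclusion is the
registered signature of `stub_fixedAbelThermodynamicLimit` verbatim (stated as an implication; registered helper `helper_fixedAbelTLOfAbelRowLocality`). [folklore] -/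
theorem helper_fixedAbelTLOfAbelRowLocality :
    (∀ (ω₂ lam β γ T ε : ℝ), 0 < ω₂ → 0 < lam → 0 < β → 0 < γ → 0 < T → 0 < ε → ∀ s : ℝ, 0 < s → s ≤ 1 → ∀ u : (L : ℕ) → Literature.MathematicalPhysics.KineticTheory.HeatConduction.PhaseSpace L → ℝ, (∀ L : ℕ, 2 ≤ L → ContDiff ℝ 2 (u L) ∧ MeasureTheory.MemLp (u L) 2 ((Literature.MathematicalPhysics.KineticTheory.HeatConduction.pinnedChain ω₂ lam β γ).gibbsMeasure L T) ∧ ∀ x, (Literature.MathematicalPhysics.KineticTheory.HeatConduction.pinnedChain ω₂ lam β γ).flipGenerator L T T ε (u L) x = s * u L x - ∑ i : Fin L, (Literature.MathematicalPhysics.KineticTheory.HeatConduction.pinnedChain ω₂ lam β γ).bondCurrent L i x) → ∃ K B : ℝ, (∀ L : ℕ, 2 ≤ L → ∀ i : Fin L, |MeasureTheory.integral ((Literature.MathematicalPhysics.KineticTheory.HeatConduction.pinnedChain ω₂ lam β γ).gibbsMeasure L T) (fun x => (Literature.MathematicalPhysics.KineticTheory.HeatConduction.pinnedChain ω₂ lam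 β γ).bondCurrent L i x * u L x)| ≤ B) ∧ ∀ η : ℝ, 0 < η → ∃ R L₀ : ℕ, ∀ L : ℕ, L₀ ≤ L → ∀ i : Fin L, R ≤ i.val → i.val + R < L → |MeasureTheory.integral ((Literature.MathematicalPhysics.KineticTheory.HeatConduction.pinnedChain ω₂ lam β γ).gibbsMeasure L T) (fun x => (Literature.MathematicalPhysics.KineticTheory.HeatConduction.pinnedChain ω₂ lam β γ).bondCurrent L i x * u L x) - K| ≤ η) → ∀ (ω₂ lam β γ T ε : ℝ), 0 < ω₂ → 0 < lam → 0 < β → 0 < γ → 0 < T → 0 < ε → ∀ s : ℝ, 0 < s → s ≤ 1 → ∀ u : (L : ℕ) → Literature.MathematicalPhysics.KineticTheory.HeatConduction.PhaseSpace L → ℝ, (∀ L : ℕ, 2 ≤ L → ContDiff ℝ 2 (u L) ∧ MeasureTheory.MemLp (u L) 2 ((Literature.MathematicalPhysics.KineticTheory.HeatConduction.pinnedChain ω₂ lam β γ).gibbsMeasure L T) ∧ ∀ x, (Literature.MathematicalPhysics.KineticTheory.HeatConduction.pinnedChain ω₂ lam β γ).flipGenerator L T T ε (u L) x = s * u L x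 - ∑ i : Fin L, (Literature.MathematicalPhysics.KineticTheory.HeatConduction.pinnedChain ω₂ lam β γ).bondCurrent L i x) → ∃ K : ℝ, Filter.Tendsto (fun L : ℕ => (MeasureTheory.integral ((Literature.MathematicalPhysics.KineticTheory.HeatConduction.pinnedChain ω₂ lam β γ).gibbsMeasure L T) (fun x => (∑ i : Fin L, (Literature.MathematicalPhysics.KineticTheory.HeatConduction.pinnedChain ω₂ lam β γ).bondCurrent L i x) * u L x)) / ((L : ℝ) - 1)) Filter.atTop (nhds K) := by
  intro hX ω₂ lam β γ T ε hω hl hβ hγ hT hε s hs hs1 u hu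
  obtain ⟨K, B, hB, hη⟩ := hX ω₂ lam β γ T ε hω hl hβ hγ hT hε s hs hs1 u hu
  refine ⟨K, ?_⟩
  set P := pinnedChain ω₂ lam β γ with hP
  -- `∫ J_L u_L = Σ_i ∫ j_i u_L` for `L ≥ 2`
  have key : ∀ L : ℕ, 2 ≤ L →
      MeasureTheory.integral (P.gibbsMeasure L T) (fun x => (∑ i : Fin L, P.bondCurrent L i x) * u L x) =
        ∑ i : Fin L, MeasureTheory.integral (P.gibbsMeasure L T) (fun x => P.bondCurrent L i x * u L x) := by
    intro L hL
    have hint : ∀ i : Fin L, Integrable (fun x => P.bondCurrent L i x * u L x) (P.gibbsMeasure L T) :=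
      fun i => (memLp_bondCurrent_gibbsMeasure hω hl.le hβ.le γ L hT i).integrable_mul (hu L hL).2.1
    rw [← integral_finsetSum _ fun i _ => hint i]
    refine integral_congr_ae (ae_of_all _ fun x => ?_)
    simp only [Finset.sum_mul]
  have h := tendsto_rowAverage
    (a := fun L i => MeasureTheory.integral (P.gibbsMeasure L T) (fun x => P.bondCurrent L i x * u L x)) hB hη
  refine h.congr' ?_
  filter_upwards [eventually_ge_atTop 2] with L hL
  rw [key L hL]

end Summit.AtomisticToContinuum.FouriersLaw.Cruxes.NoisyFourier.AbelKapitzaEvenCorrector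

end
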